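/-
Copyright (c) 2026 the pub-hodgecm-mathlib formalisation cell (harness21).  Prover seat hodgecm-mathlib-LH4-p11 (g0), req620 Track A «(D-RAM) FOUR-FRAME» squad
(heir LEAD F0P3a-plan (g19) «FOUR-FRAME SKELETON LANDED» EMIT #8; dealer LH4-plan (g10) WORD #34).  2026-09-03.
-/
import Summits.HodgeConjecture.HodgeConjecture.Theorems.F0P3cDyRamDiagonalTubeFixed   -- ★ p855052 (this seat): `mulVec_diagonal_eq_smul_add_sum`, the tube criterion; brings ★ `UnitaryLatticeTreeFrameChange` (`mapGL_mapGL_inv`)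
import HarnessLib

/-!
# Crux `H413`, line LH4 «(D-RAM) FOUR-FRAME» road — unit U3_Laws (iii), TIER 2 SUPPORT: THE MODULE CRITERION IN THE DIAGONAL MODEL, EXACT (TARGET E)

Cell `hodgecm-mathlib` (D-0151), FLOOR 0, crux item H413 = `stmt-HodgeConjecture-24833`, route of record `HCCMUnconditional`; squad F0∕P3c∕LH4 (req618∕req620).  THEOREMS ONLY
(no `def`, no instance, no notation, no `sorry`, default heartbeats); lane `--supports stmt-HodgeConjecture-24833 --as helper` (count-neutral).

WHAT IS PROVED.  In the diagonal model of a frame (★ p855032: `T = diag(s)` acting on `(K³, diag d)`), ★ #0a A-0's module criterion becomes an EXACT, frame-free statement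
about an arbitrary `𝒪`-submodule `M ⊆ K^N`:  (≤, generic `N`, `|s_i| ≤ 1`)  `diag(s)·M ≤ M ↔ ∀ x ∈ M, Σ_i (s_i − s_j)·x_i·e_i ∈ M`  (any slot `j`; the `j`-summand is `0`);
(=, `N = 3`, `|s_i| = 1`)  `diag(s)·M ≤ M → diag(s)·M = M` — containment already forces equality, for EVERY `𝒪`-submodule (no lattice hypothesis), because
`diag(s)⁻¹ = e₃⁻¹(diag(s)² − e₁·diag(s) + e₂·1)` is an `𝒪`-polynomial in `diag(s)` (Cayley–Hamilton with unit constant term `e₃ = s₀s₁s₂`); hence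
`diag(s)·M = M ↔ ∀ x ∈ M, Σ_i (s_i − s_j)·x_i·e_i ∈ M`.  The tube criterion (★ p855052), the big-tube necessity (★ p855091, LH4-p14) and the sub-building rule (TARGET B) are
the termwise corollaries; the census of the stable law (S) needs this exact form together with ★ A-1's glue data (LH4-p11 DATUM §5).
* `mapGL_diagonal_le_iff_sum_single_mem` (≤, generic `N`).
* `inv_mulVec_eq_of_diagonal_three` — `diag(s)⁻¹·x = e₃⁻¹·(diag(s)(diag(s) x) − e₁·diag(s) x + e₂·x)` on `K³`.
* `mapGL_eq_of_mapGL_le_of_diagonal_three` (≤ ⇒ =, `N = 3`, units).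
* `mapGL_diagonal_eq_iff_sum_single_mem` (the head, `N = 3`).
HONEST LABEL.  Count-neutral; nothing printed is asserted; the census laws stay PROVER TARGETS; `HC_CM` is proved only modulo the 7 printed citations (2 remaining named inputs:
hLiu418 = `stmt-HodgeConjecture-24832`, h413 = `stmt-HodgeConjecture-24833`) until rung 0 closes.

## References
* [Kottwitz1986BaseChangeUnits] R. E. Kottwitz, *Base change for unit elements of Hecke algebras*, Compositio Math. 60 (1986), §1 pp. 240–241 (fixed lattices of a torus element).
* [Rogawski1990] J. D. Rogawski, *Automorphic Representations of Unitary Groups in Three Variables*, Ann. of Math. Stud. 123 (1990), §4.9 Prop. 4.9.1 (a) p. 55.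
* [Serre1980Trees] J.-P. Serre, *Trees*, Springer (1980), Ch. II §1.1.
-/

set_option autoImplicit false

noncomputable section

namespace Summit.HodgeConjecture.HodgeConjecture.Cruxes.H413.F0P3cDyRamDiagonalModuleCriterion

open Matrix
open Literature.NumberTheory.Automorphic Literature.NumberTheory.Automorphic.HermitianLattice
open Literature.NumberTheory.Automorphic.UnitaryLatticeTree
open Summit.HodgeConjecture.HodgeConjecture.Cruxes.H413.F0P3cDyRamDiagonalTubeFixed (mulVec_diagonal_eq_smul_add_sum)
open scoped Valued WithZero Matrix MatrixGroups

variable {K : Type*} [Field K] [Valued K ℤᵐ⁰] {N : ℕ}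

/-- **(≤) THE MODULE CRITERION FOR CONTAINMENT**, generic `N`: for `T = diag(s)` with `|s_i| ≤ 1` and any slot `j`,
`diag(s)·M ≤ M ↔ ∀ x ∈ M, Σ_i (s_i − s_j)·x_i·e_i ∈ M` (★ `mulVec_diagonal_eq_smul_add_sum`: `diag(s) x = s_j·x + Σ_i (s_i − s_j)·x_i·e_i`, and `s_j·x ∈ M`).
[cite: Kottwitz1986BaseChangeUnits, §1 pp. 240–241] [cite: Serre1980Trees, II §1.1] -/
theorem mapGL_diagonal_le_iff_sum_single_mem (s : Fin N → K) (hs : ∀ i, Valued.v (s i) ≤ 1) (T : GL (Fin N) K)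
    (hT : (T : Matrix (Fin N) (Fin N) K) = Matrix.diagonal s) (j : Fin N) (M : Submodule 𝒪[K] (Fin N → K)) :
    mapGL T M ≤ M ↔ ∀ x ∈ M, (∑ i, (s i - s j) • (Pi.single i (x i) : Fin N → K)) ∈ M := by
  rw [mapGL, Submodule.map_le_iff_le_comap]
  refine forall₂_congr fun x hx => ?_
  rw [Submodule.mem_comap, LinearMap.restrictScalars_apply, Matrix.toLin'_apply, hT, mulVec_diagonal_eq_smul_add_sum s j x]
  exact Submodule.add_mem_iff_right M (M.smul_mem (⟨s j, hs j⟩ : 𝒪[K]) hx)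

omit [Valued K ℤᵐ⁰] in
/-- **CAYLEY–HAMILTON FOR THE UNIT DIAGONAL, `N = 3`**: `diag(s)⁻¹ x = e₃⁻¹·(diag(s)(diag(s) x) − e₁·diag(s) x + e₂·x)` with `e₁ = s₀+s₁+s₂`, `e₂ = s₀s₁+s₀s₂+s₁s₂`,
`e₃ = s₀s₁s₂ ≠ 0`. [cite: Serre1980Trees, II §1.1] -/
theorem inv_mulVec_eq_of_diagonal_three (s : Fin 3 → K) (hs0 : ∀ i, s i ≠ 0) (x : Fin 3 → K) :
    (Matrix.diagonal fun i => (s i)⁻¹).mulVec x =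
      (s 0 * s 1 * s 2)⁻¹ • ((Matrix.diagonal s).mulVec ((Matrix.diagonal s).mulVec x) - (s 0 + s 1 + s 2) • (Matrix.diagonal s).mulVec x
        + (s 0 * s 1 + s 0 * s 2 + s 1 * s 2) • x) := by
  have h0 := hs0 0; have h1 := hs0 1; have h2 := hs0 2
  funext l
  simp only [Matrix.mulVec_diagonal, Pi.smul_apply, Pi.add_apply, Pi.sub_apply, smul_eq_mul]
  fin_cases l <;> simp <;> field_simp <;> ring

/-- **(≤ ⇒ =) CONTAINMENT FORCES EQUALITY FOR A UNIT DIAGONAL, `N = 3`**: if `|s_i| = 1` and `diag(s)·M ≤ M` then `diag(s)·M = M` — for EVERY `𝒪`-submodule `M ⊆ K³`: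
`diag(s)⁻¹ x` is an `𝒪`-combination of `x, diag(s) x, diag(s)² x` (`inv_mulVec_eq_of_diagonal_three`; `|e₁|, |e₂| ≤ 1`, `|e₃| = 1`), so `diag(s)⁻¹·M ≤ M` as well.
[cite: Kottwitz1986BaseChangeUnits, §1 pp. 240–241] [cite: Serre1980Trees, II §1.1] -/
theorem mapGL_eq_of_mapGL_le_of_diagonal_three (s : Fin 3 → K) (hs : ∀ i, Valued.v (s i) = 1) (T : GL (Fin 3) K)
    (hT : (T : Matrix (Fin 3) (Fin 3) K) = Matrix.diagonal s) (M : Submodule 𝒪[K] (Fin 3 → K)) (hle : mapGL T M ≤ M) : mapGL T M = M := by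
  classical
  have hs0 : ∀ i, s i ≠ 0 := fun i h0 => by have := hs i; rw [h0, map_zero] at this; exact zero_ne_one this
  refine le_antisymm hle ?_
  -- `T x ∈ M` for `x ∈ M`
  have hTx : ∀ x ∈ M, (Matrix.diagonal s).mulVec x ∈ M := fun x hx => by
    have h := hle (Submodule.mem_map.2 ⟨x, hx, rfl⟩)
    rwa [LinearMap.restrictScalars_apply, Matrix.toLin'_apply, hT] at h
  -- the inverse is the diagonal of `s⁻¹`
  have hTinv : (((T⁻¹ : GL (Fin 3) K)) : Matrix (Fin 3) (Fin 3) K) = Matrix.diagonal fun i => (s i)⁻¹ :=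
    Units.inv_eq_of_mul_eq_one_right (by
      rw [hT, Matrix.diagonal_mul_diagonal, ← Matrix.diagonal_one]
      congr 1; funext i; exact mul_inv_cancel₀ (hs0 i))
  -- scalars
  have he1 : Valued.v (s 0 + s 1 + s 2) ≤ 1 :=
    (Valuation.map_add _ _ _).trans (max_le ((Valuation.map_add _ _ _).trans (max_le (hs 0).le (hs 1).le)) (hs 2).le)
  have he2 : Valued.v (s 0 * s 1 + s 0 * s 2 + s 1 * s 2) ≤ 1 := by
    refine (Valuation.map_add _ _ _).trans (max_le ((Valuation.map_add _ _ _).trans (max_le ?_ ?_)) ?_) <;>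
      rw [map_mul] <;> exact mul_le_one' (le_of_eq (hs _)) (le_of_eq (hs _))
  have he3 : Valued.v (s 0 * s 1 * s 2)⁻¹ ≤ 1 := by rw [map_inv₀, map_mul, map_mul, hs 0, hs 1, hs 2, mul_one, mul_one, inv_one]
  -- `M ≤ T M`: `x = T (T⁻¹ x)` with `T⁻¹ x ∈ M`
  intro x hx
  have hinv : (((T⁻¹ : GL (Fin 3) K)) : Matrix (Fin 3) (Fin 3) K).mulVec x ∈ M := by
    rw [hTinv, inv_mulVec_eq_of_diagonal_three s hs0 x]
    refine M.smul_mem (⟨(s 0 * s 1 * s 2)⁻¹, he3⟩ : 𝒪[K]) (M.add_mem (M.sub_mem (hTx _ (hTx x hx)) ?_) ?_)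
    · exact M.smul_mem (⟨s 0 + s 1 + s 2, he1⟩ : 𝒪[K]) (hTx x hx)
    · exact M.smul_mem (⟨s 0 * s 1 + s 0 * s 2 + s 1 * s 2, he2⟩ : 𝒪[K]) hx
  refine Submodule.mem_map.2 ⟨_, hinv, ?_⟩
  rw [LinearMap.restrictScalars_apply, Matrix.toLin'_apply, Matrix.mulVec_mulVec, ← Units.val_mul, mul_inv_cancel, Units.val_one, Matrix.one_mulVec]

/-- **THE MODULE CRITERION IN THE DIAGONAL MODEL, EXACT (`N = 3`)** — ★ #0a A-0 in model currency, both directions, for EVERY `𝒪`-submodule `M ⊆ K³`: for `T = diag(s)` with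
`|s_i| = 1` and any slot `j`,  `diag(s)·M = M ↔ ∀ x ∈ M, Σ_i (s_i − s_j)·x_i·e_i ∈ M`.  With `s = (α, β, 1)`, `j = 2` the right side reads `(α − 1)·x₀e₀ + (β − 1)·x₁e₁ ∈ M`,
i.e. `(α − 1, β − 1) ∈ M_Λ` (★ #0a H12 defect set at the coordinate projections).  Termwise corollaries: ★ p855052 (tube), ★ p855091 (big tube), TARGET B (sub-building rule).
[cite: Kottwitz1986BaseChangeUnits, §1 pp. 240–241] [cite: Rogawski1990, §4.9 Prop. 4.9.1 (a) p. 55] -/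
theorem mapGL_diagonal_eq_iff_sum_single_mem (s : Fin 3 → K) (hs : ∀ i, Valued.v (s i) = 1) (T : GL (Fin 3) K)
    (hT : (T : Matrix (Fin 3) (Fin 3) K) = Matrix.diagonal s) (j : Fin 3) (M : Submodule 𝒪[K] (Fin 3 → K)) :
    mapGL T M = M ↔ ∀ x ∈ M, (∑ i, (s i - s j) • (Pi.single i (x i) : Fin 3 → K)) ∈ M := by
  rw [← mapGL_diagonal_le_iff_sum_single_mem s (fun i => (hs i).le) T hT j M]
  exact ⟨fun h => h.le, mapGL_eq_of_mapGL_le_of_diagonal_three s hs T hT M⟩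

end Summit.HodgeConjecture.HodgeConjecture.Cruxes.H413.F0P3cDyRamDiagonalModuleCriterion

end
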